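import Literature.NumberTheory.Automorphic.UnitaryGroupLocalReflections
import Literature.NumberTheory.Automorphic.LocalPiSchwartzBruhatFourier
import Literature.NumberTheory.Automorphic.LocalFieldHaarBalls
import HarnessLib

/-!
# The norm form of `E_v/F_v` is COERCIVE at a non-split place, and quasi-reflection families enter every open subgroup

Topic `NumberTheory/Automorphic`; namespace `Literature.NumberTheory.Automorphic.UnitaryGroup`.  KERNEL ONLY: theorems; no
definition, no named fact, no record, no `sorry`.  Sequel of `UnitaryGroupLocalReflections.lean` (quasi-reflections
`1 + a · u ⊗ uᵀJ_v` of `U(J)(F_v)`, coordinates `E_v = F_v ⊕ F_v δ`).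

Setting as there: `E/F` quadratic number fields, `c`, `δ` (`c δ = -δ ≠ 0`, `δ² = d`), `T` symmetric, `J = T ⊗ 1`, a finite place `v`,
sizes measured by the normalised absolute value `|·| = normAbs F_v` of the coordinates (`s(z) = max(|re z|, |im z|)` is a `K`-norm
on `E_v` in the sense of [WeilBNT1967, Chap. II §1 Def. 1]).

* §1 ultrametric bookkeeping (`normAbs_sum_le`, `normAbs_one_sub_eq_one`);
* §2 sizes of products in coordinates and the **COERCIVITY of the norm form at a non-split place**
  (`exists_coercivity_of_isField`): if `E_v` is a field then `d` is not a square in `F_v`, the form `α² - dβ²` («`E` munie de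
  la norme», the anisotropic plane of [MoeglinVignerasWaldspurger1987, Chap. 1 I.11 (4 b)]) has no non-trivial zero, and by
  compactness of the unit sphere of the `K`-norm `max(|α|,|β|)` and scaling by the value group ([WeilBNT1967, Chap. II §1
  Prop. 1, Cor. 1–2]) `|α² - dβ²| ≥ q^{-k₀} max(|α|,|β|)²`;
* §3 the one-parameter families `t ↦ r_{u,t} = 1 + a(t) · u ⊗ uᵀJ_v`, `a(t) = (2dt² + 2tδ)/(c_u(1 - dt²))`, of quasi-reflections
  along a rational anisotropic `u` ([Dieudonne1971GroupesClassiques, Chap. II §4]): the isometry relation (`reflParam_rel`) and,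
  by continuity into `U(J)(F_v) ≤ GL_N(E_v)`, **`exists_ball_reflection_mem`**: for every open subgroup `K` there is a ball
  `𝔭^{n₁}` of parameters `t` with `r_{u,t} ∈ K`.

Written for the expansion property of `U(J)(F_v)` on `𝕎_v` (`UnitaryGroupLocalExpansionNonsplit.lean`) behind the
admissibility of the rank-one theta lift at a non-split place.  Nothing of the cited sources is asserted.

## References
* [WeilBNT1967] A. Weil, *Basic Number Theory* (1967), Chap. II §1 (Def. 1, Prop. 1 and Cor. 1–2).
* [MoeglinVignerasWaldspurger1987] C. Mœglin, M.-F. Vignéras, J.-L. Waldspurger, LNM 1291 (1987), Chap. 1 I.11.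
* [Dieudonne1971GroupesClassiques] J. Dieudonné, *La géométrie des groupes classiques* (1971), Chap. II §4.
-/

set_option autoImplicit false

noncomputable section

open Matrix NumberField IsDedekindDomain Filter
open scoped NNReal Topology
open Literature.RepresentationTheory.HeisenbergGroup
open Literature.NumberTheory.GaloisRepresentations.IsNonarchimedeanLocalField
open Literature.NumberTheory.GelbartRogawski1991.UnitaryDualPair.LocalSplitting (iota iota_def localPairing localGram LocalSp)

namespace Literature.NumberTheory.Automorphic.UnitaryGroup


/-! ## §1 Ultrametric bookkeeping -/

section Ultra

variable {K : Type*} [Field K] [ValuativeRel K] [TopologicalSpace K] [IsNonarchimedeanLocalField K]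

/-- finite ultrametric sums: if every term has `|f i| ≤ C` then `|Σ f i| ≤ C`. [cite: WeilBNT1967, Chap. II §1 Def. 1] -/
theorem normAbs_sum_le {ι : Type*} (s : Finset ι) (f : ι → K) {C : ℝ≥0} (h : ∀ i ∈ s, normAbs K (f i) ≤ C) :
    normAbs K (∑ i ∈ s, f i) ≤ C := by
  classical
  induction s using Finset.induction_on with
  | empty => simp
  | insert a s ha ih =>
    rw [Finset.sum_insert ha]
    refine (normAbs_add_le_max _ _).trans (max_le (h a (Finset.mem_insert_self a s)) (ih fun i hi => ?_))
    exact h i (Finset.mem_insert_of_mem hi)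

/-- `|1 - x| = 1` for `|x| < 1` (the ultrametric inequality is an equality off the diagonal). [cite: WeilBNT1967, Chap. II §1 Def. 1] -/
theorem normAbs_one_sub_eq_one {x : K} (hx : normAbs K x < 1) : normAbs K (1 - x) = 1 := by
  rw [sub_eq_add_neg, LocalFieldHaar.normAbs_add_eq_of_lt (by rwa [normAbs_neg, map_one]), map_one]

end Ultra

/-! ## §2 Sizes in the coordinates `E_v = F_v ⊕ F_v δ` and the coercivity of the norm form at a non-split place -/

section Coords

variable {F : Type} [Field F] [NumberField F] (E : Type) [Field E] [NumberField E] [Algebra F E]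
  [Algebra.IsQuadraticExtension F E] (c : E ≃ₐ[F] E)
  {δ : E} (hcδ : c δ = -δ) (hδ : δ ≠ 0) {d : F} (hd : δ * δ = algebraMap F E d)
  (v : HeightOneSpectrum (𝓞 F))

include hd in
/-- size of a product, real part: `|re(z w)| ≤ max(1,|d|) s(z) s(w)`, `s = max(|re|, |im|)`. [cite: WeilBNT1967, Chap. II §1 Def. 1] -/
theorem normAbs_re_mul_le (z w : UnitaryGroup.LocalRing E v) :
    normAbs (v.adicCompletion F)
        (QuadraticCoordinates.re (quadraticLocalEquiv E v c hcδ hδ).toLinearEquiv.toAddEquiv (z * w)) ≤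
      max 1 (normAbs (v.adicCompletion F) (d : v.adicCompletion F)) *
        max (normAbs (v.adicCompletion F) (QuadraticCoordinates.re (quadraticLocalEquiv E v c hcδ hδ).toLinearEquiv.toAddEquiv z))
            (normAbs (v.adicCompletion F) (QuadraticCoordinates.im (quadraticLocalEquiv E v c hcδ hδ).toLinearEquiv.toAddEquiv z)) *
        max (normAbs (v.adicCompletion F) (QuadraticCoordinates.re (quadraticLocalEquiv E v c hcδ hδ).toLinearEquiv.toAddEquiv w))
            (normAbs (v.adicCompletion F) (QuadraticCoordinates.im (quadraticLocalEquiv E v c hcδ hδ).toLinearEquiv.toAddEquiv w)) := by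
  have hq := isQuadraticCoordinates_local E v c hcδ hδ hd
  rw [hq.re_mul]
  refine (normAbs_add_le_max _ _).trans (max_le ?_ ?_)
  · rw [map_mul]
    calc _ ≤ 1 * (normAbs (v.adicCompletion F) _ * normAbs (v.adicCompletion F) _) := by rw [one_mul]
      _ ≤ _ := by
        rw [mul_assoc]
        exact mul_le_mul' (le_max_left _ _) (mul_le_mul' (le_max_left _ _) (le_max_left _ _))
  · rw [map_mul, map_mul, mul_assoc]
    exact mul_le_mul' (le_max_right _ _) (mul_le_mul' (le_max_right _ _) (le_max_right _ _))

include hd in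
/-- size of a product, imaginary part: `|im(z w)| ≤ max(1,|d|) s(z) s(w)`. [cite: WeilBNT1967, Chap. II §1 Def. 1] -/
theorem normAbs_im_mul_le (z w : UnitaryGroup.LocalRing E v) :
    normAbs (v.adicCompletion F)
        (QuadraticCoordinates.im (quadraticLocalEquiv E v c hcδ hδ).toLinearEquiv.toAddEquiv (z * w)) ≤
      max 1 (normAbs (v.adicCompletion F) (d : v.adicCompletion F)) *
        max (normAbs (v.adicCompletion F) (QuadraticCoordinates.re (quadraticLocalEquiv E v c hcδ hδ).toLinearEquiv.toAddEquiv z))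
            (normAbs (v.adicCompletion F) (QuadraticCoordinates.im (quadraticLocalEquiv E v c hcδ hδ).toLinearEquiv.toAddEquiv z)) *
        max (normAbs (v.adicCompletion F) (QuadraticCoordinates.re (quadraticLocalEquiv E v c hcδ hδ).toLinearEquiv.toAddEquiv w))
            (normAbs (v.adicCompletion F) (QuadraticCoordinates.im (quadraticLocalEquiv E v c hcδ hδ).toLinearEquiv.toAddEquiv w)) := by
  have hq := isQuadraticCoordinates_local E v c hcδ hδ hd
  rw [hq.im_mul]
  refine (normAbs_add_le_max _ _).trans (max_le ?_ ?_)
  · rw [map_mul, mul_assoc]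
    calc _ ≤ 1 * (normAbs (v.adicCompletion F) _ * normAbs (v.adicCompletion F) _) := by rw [one_mul]
      _ ≤ _ := mul_le_mul' (le_max_left _ _) (mul_le_mul' (le_max_left _ _) (le_max_right _ _))
  · rw [map_mul, mul_assoc]
    calc _ ≤ 1 * (normAbs (v.adicCompletion F) _ * normAbs (v.adicCompletion F) _) := by rw [one_mul]
      _ ≤ _ := mul_le_mul' (le_max_left _ _) (mul_le_mul' (le_max_right _ _) (le_max_left _ _))

include c hcδ hδ hd in
/-- **`d` is not a square in `F_v` when `E_v` is a field**: otherwise `(r + δ)(r - δ) = r² - d = 0` with both factors non-zero.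
[cite: MoeglinVignerasWaldspurger1987, Chap. 1 I.11 (4 b)] -/
theorem mul_self_ne_d_of_isField (hE : IsField (UnitaryGroup.LocalRing E v)) (r : v.adicCompletion F) :
    r * r ≠ (d : v.adicCompletion F) := by
  intro hr
  have hq := isQuadraticCoordinates_local E v c hcδ hδ hd
  letI := hE.toField
  set δv := algebraMap E (UnitaryGroup.LocalRing E v) δ with hδv
  have hprod : (toLocalRing E v r + δv) * (toLocalRing E v r - δv) = 0 := by
    have : (toLocalRing E v r + δv) * (toLocalRing E v r - δv) = toLocalRing E v r * toLocalRing E v r - δv * δv := by ring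
    rw [this, ← map_mul, hq.mul_self, hr, sub_self]
  rcases mul_eq_zero.1 hprod with h1 | h1
  · have := congrArg (QuadraticCoordinates.im (quadraticLocalEquiv E v c hcδ hδ).toLinearEquiv.toAddEquiv) h1
    rw [map_add, hq.im_map, map_zero, hq.im_delta] at this
    norm_num at this
  · have := congrArg (QuadraticCoordinates.im (quadraticLocalEquiv E v c hcδ hδ).toLinearEquiv.toAddEquiv) h1
    rw [map_sub, hq.im_map, map_zero, hq.im_delta] at this
    norm_num at this

include c hcδ hδ hd in
/-- the norm form `α² - d β²` has no non-trivial zero at a non-split place. [cite: MoeglinVignerasWaldspurger1987, Chap. 1 I.11 (4 b)] -/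
theorem normForm_ne_zero_of_isField (hE : IsField (UnitaryGroup.LocalRing E v)) {α β : v.adicCompletion F}
    (h : α ≠ 0 ∨ β ≠ 0) : α ^ 2 - (d : v.adicCompletion F) * β ^ 2 ≠ 0 := by
  intro h0
  by_cases hβ : β = 0
  · rcases h with hα | hβ'
    · apply hα
      rw [hβ] at h0
      simpa using h0
    · exact hβ' hβ
  · apply mul_self_ne_d_of_isField E c hcδ hδ hd v hE (α / β)
    field_simp
    linear_combination h0

include c hcδ hδ hd in
/-- **COERCIVITY of the norm form at a non-split place**: there is `k₀` with `q^{-k₀} · max(|α|, |β|)² ≤ |α² - d β²|` for all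
`α, β ∈ F_v` (compactness of the sphere `max(|α|,|β|) = 1` on which the anisotropic form does not vanish, then scaling by the
value group). [cite: WeilBNT1967, Chap. II §1 Prop. 1 Cor. 1–2] -/
theorem exists_coercivity_of_isField (hE : IsField (UnitaryGroup.LocalRing E v)) :
    ∃ k₀ : ℤ, ∀ α β : v.adicCompletion F,
      ((residueFieldCard (v.adicCompletion F) : ℝ≥0)⁻¹) ^ k₀ *
          max (normAbs (v.adicCompletion F) α) (normAbs (v.adicCompletion F) β) ^ 2 ≤
        normAbs (v.adicCompletion F) (α ^ 2 - (d : v.adicCompletion F) * β ^ 2) := by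
  set Kv := v.adicCompletion F with hKv
  set ρ : ℝ≥0 := ((residueFieldCard Kv : ℝ≥0)⁻¹) with hρ
  -- the sphere `S = (𝒪 × 𝒪) \\ (𝔭 × 𝔭)` is compact and the form does not vanish on it
  set S : Set (Kv × Kv) := (primePowBall Kv 0 ×ˢ primePowBall Kv 0) \ (primePowBall Kv 1 ×ˢ primePowBall Kv 1) with hS
  have hSc : IsCompact S :=
    ((isCompact_primePowBall 0).prod (isCompact_primePowBall 0)).diff ((isOpen_primePowBall 1).prod (isOpen_primePowBall 1))
  set Qf : Kv × Kv → Kv := fun p => p.1 ^ 2 - (d : Kv) * p.2 ^ 2 with hQf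
  have hQc : Continuous Qf := by fun_prop
  have h0 : (0 : Kv) ∉ Qf '' S := by
    rintro ⟨⟨α, β⟩, hp, hq0⟩
    refine normForm_ne_zero_of_isField E c hcδ hδ hd v hE (α := α) (β := β) ?_ hq0
    by_contra hne
    rw [not_or, not_ne_iff, not_ne_iff] at hne
    obtain ⟨rfl, rfl⟩ := hne
    exact hp.2 ⟨zero_mem_primePowBall 1, zero_mem_primePowBall 1⟩
  have hopen : (Qf '' S)ᶜ ∈ 𝓝 (0 : Kv) := (hSc.image hQc).isClosed.isOpen_compl.mem_nhds h0
  obtain ⟨k₀, hk₀⟩ := exists_primePowBall_subset_of_mem_nhds_zero hopen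
  refine ⟨k₀, fun α β => ?_⟩
  -- the bound on the sphere
  have hsphere : ∀ p ∈ S, ρ ^ (k₀ : ℤ) < normAbs Kv (Qf p) := by
    intro p hp
    by_contra hle
    exact hk₀ ((mem_primePowBall_iff).2 (not_lt.1 hle)) ⟨p, hp, rfl⟩
  by_cases hαβ : α = 0 ∧ β = 0
  · obtain ⟨rfl, rfl⟩ := hαβ
    simp
  -- scale onto the sphere: `m = max(|α|,|β|) = ρ^e`, `|a| = ρ^{-e}`
  have hm0 : max (normAbs Kv α) (normAbs Kv β) ≠ 0 := by
    intro h
    apply hαβ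
    constructor
    · exact (map_eq_zero (normAbs Kv)).1 (le_antisymm (le_of_max_le_left h.le) zero_le)
    · exact (map_eq_zero (normAbs Kv)).1 (le_antisymm (le_of_max_le_right h.le) zero_le)
  obtain ⟨e, he⟩ : ∃ e : ℤ, max (normAbs Kv α) (normAbs Kv β) = ρ ^ e := by
    rcases le_total (normAbs Kv α) (normAbs Kv β) with hle | hle
    · rw [max_eq_right hle]
      have hβ0 : β ≠ 0 := fun h => hm0 (by rw [max_eq_right hle, h, map_zero])
      exact exists_normAbs_eq_inv_zpow hβ0
    · rw [max_eq_left hle]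
      have hα0 : α ≠ 0 := fun h => hm0 (by rw [max_eq_left hle, h, map_zero])
      exact exists_normAbs_eq_inv_zpow hα0
  obtain ⟨a, ha0, ha⟩ := exists_normAbs_eq_inv_zpow_of_int (F := Kv) (-e)
  have hρ0 : ρ ≠ 0 := inv_residueFieldCard_pos.ne'
  have hea : normAbs Kv a * max (normAbs Kv α) (normAbs Kv β) = 1 := by
    rw [ha, he, ← zpow_add₀ hρ0, neg_add_cancel, zpow_zero]
  have hmem : (a * α, a * β) ∈ S := by
    have h1 : ∀ γ, normAbs Kv γ ≤ max (normAbs Kv α) (normAbs Kv β) → normAbs Kv (a * γ) ≤ ρ ^ (0 : ℤ) := by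
      intro γ hγ
      rw [zpow_zero, map_mul, ← hea]
      exact mul_le_mul' le_rfl hγ
    refine ⟨⟨(mem_primePowBall_iff).2 (h1 α (le_max_left _ _)), (mem_primePowBall_iff).2 (h1 β (le_max_right _ _))⟩, ?_⟩
    rintro ⟨hα1, hβ1⟩
    rw [mem_primePowBall_iff, map_mul, zpow_one] at hα1 hβ1
    have : normAbs Kv a * max (normAbs Kv α) (normAbs Kv β) ≤ ρ := by
      rw [mul_max_of_nonneg _ _ zero_le]
      exact max_le hα1 hβ1
    rw [hea] at this
    exact not_lt.2 this inv_residueFieldCard_lt_one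
  have hscale : Qf (a * α, a * β) = a ^ 2 * Qf (α, β) := by simp only [hQf]; ring
  have key := hsphere _ hmem
  rw [hscale, map_mul, map_pow] at key
  -- `ρ^{k₀} < |a|² |Q|` and `|a| m = 1` give `ρ^{k₀} m² ≤ |Q|`
  have : ρ ^ k₀ * max (normAbs Kv α) (normAbs Kv β) ^ 2 <
      normAbs Kv a ^ 2 * normAbs Kv (Qf (α, β)) * max (normAbs Kv α) (normAbs Kv β) ^ 2 :=
    mul_lt_mul_of_pos_right key (pow_pos (pos_iff_ne_zero.2 hm0) 2)
  rw [mul_right_comm, ← mul_pow, hea, one_pow, one_mul] at this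
  exact this.le

end Coords


/-! ## §3 One-parameter families of quasi-reflections inside every open subgroup -/

section Family

variable {F : Type} [Field F] [NumberField F] (E : Type) [Field E] [NumberField E] [Algebra F E]
  [Algebra.IsQuadraticExtension F E] (c : E ≃ₐ[F] E) {N : ℕ}
  {δ : E} (hcδ : c δ = -δ) (hδ : δ ≠ 0) {d : F} (hd : δ * δ = algebraMap F E d)
  (T : Matrix (Fin N) (Fin N) F) (hT : T.IsSymm)
  {J : Matrix (Fin N) (Fin N) E} (hJ : J = T.map (algebraMap F E))
  (v : HeightOneSpectrum (𝓞 F))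

include hd in
/-- the parameter `a(t) = (2dt² + 2t δ)/(c_u (1 - dt²))` satisfies the isometry relation `a + σa + a σa c_u = 0` (here with
`c_u` any rational scalar and `1 - dt² ≠ 0`). [cite: Dieudonne1971GroupesClassiques, Chap. II §4] -/
theorem reflParam_rel (cu : F) (hcu : cu ≠ 0) (t : v.adicCompletion F)
    (hD : 1 - (d : v.adicCompletion F) * t ^ 2 ≠ 0) :
    (quadraticLocalEquiv E v c hcδ hδ)
        (2 * (d : v.adicCompletion F) * t ^ 2 / ((cu : v.adicCompletion F) * (1 - (d : v.adicCompletion F) * t ^ 2)),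
          2 * t / ((cu : v.adicCompletion F) * (1 - (d : v.adicCompletion F) * t ^ 2))) +
      conjLocal E c v ((quadraticLocalEquiv E v c hcδ hδ)
        (2 * (d : v.adicCompletion F) * t ^ 2 / ((cu : v.adicCompletion F) * (1 - (d : v.adicCompletion F) * t ^ 2)),
          2 * t / ((cu : v.adicCompletion F) * (1 - (d : v.adicCompletion F) * t ^ 2)))) +
      (quadraticLocalEquiv E v c hcδ hδ)
        (2 * (d : v.adicCompletion F) * t ^ 2 / ((cu : v.adicCompletion F) * (1 - (d : v.adicCompletion F) * t ^ 2)),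
          2 * t / ((cu : v.adicCompletion F) * (1 - (d : v.adicCompletion F) * t ^ 2))) *
      conjLocal E c v ((quadraticLocalEquiv E v c hcδ hδ)
        (2 * (d : v.adicCompletion F) * t ^ 2 / ((cu : v.adicCompletion F) * (1 - (d : v.adicCompletion F) * t ^ 2)),
          2 * t / ((cu : v.adicCompletion F) * (1 - (d : v.adicCompletion F) * t ^ 2)))) *
      toLocalRing E v ((cu : F) : v.adicCompletion F) = 0 := by
  have hq := isQuadraticCoordinates_local E v c hcδ hδ hd
  set D₁ : v.adicCompletion F := 1 - (d : v.adicCompletion F) * t ^ 2 with hD₁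
  set α : v.adicCompletion F := 2 * (d : v.adicCompletion F) * t ^ 2 / ((cu : v.adicCompletion F) * D₁) with hα
  set β : v.adicCompletion F := 2 * t / ((cu : v.adicCompletion F) * D₁) with hβ
  set a := (quadraticLocalEquiv E v c hcδ hδ) (α, β) with ha
  have hre : QuadraticCoordinates.re (quadraticLocalEquiv E v c hcδ hδ).toLinearEquiv.toAddEquiv a = α :=
    QuadraticCoordinates.re_apply _ α β
  have him : QuadraticCoordinates.im (quadraticLocalEquiv E v c hcδ hδ).toLinearEquiv.toAddEquiv a = β :=
    QuadraticCoordinates.im_apply _ α β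
  have h1 : a + conjLocal E c v a = toLocalRing E v (2 * α) := by rw [add_conjLocal E c hcδ hδ hd v a, hre]
  have h2 : a * conjLocal E c v a = toLocalRing E v (α ^ 2 - (d : v.adicCompletion F) * β ^ 2) := by
    rw [mul_comm, conjLocal_mul_self E c hcδ hδ hd v a, hre, him]
  have hcu' : (cu : v.adicCompletion F) ≠ 0 := by
    intro h0
    apply hcu
    apply (algebraMap F (v.adicCompletion F)).injective
    rw [map_zero]
    exact h0
  rw [h1, h2, ← map_mul, ← map_add, map_eq_zero_iff _ (toLocalRing E v).injective, hα, hβ]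
  field_simp
  ring

include hcδ hδ hd hT hJ in
/-- **the quasi-reflections `r_{u,t}` along a rational anisotropic vector `u` enter every open subgroup of `U(J)(F_v)` for
`t` small**: for an open `K ≤ U(J)(F_v)` there is a ball `𝔭^{n₁}` such that for `t ∈ 𝔭^{n₁}`, `|dt²| < 1` and the unit with matrix
`1 + a(t) · u ⊗ uᵀJ_v` lies in `U(J)(F_v)` and (on the factor form) in `K`. [cite: Dieudonne1971GroupesClassiques, Chap. II §4] -/
theorem exists_ball_reflection_mem (u : Fin N → F) (hcu : (u ᵥ* T) ⬝ᵥ u ≠ 0)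
    (K : Subgroup (UnitaryGroup.localPi E c N J v)) (hK : IsOpen (K : Set (UnitaryGroup.localPi E c N J v))) :
    ∃ n₁ : ℤ, ∀ t ∈ primePowBall (v.adicCompletion F) n₁,
      normAbs (v.adicCompletion F) ((d : v.adicCompletion F) * t ^ 2) < 1 ∧
      ∃ g : UnitaryGroup.«local» E c N J v,
        (g : GL (Fin N) (UnitaryGroup.LocalRing E v)).val =
          1 + (quadraticLocalEquiv E v c hcδ hδ)
              (2 * (d : v.adicCompletion F) * t ^ 2 /
                  ((((u ᵥ* T) ⬝ᵥ u : F) : v.adicCompletion F) * (1 - (d : v.adicCompletion F) * t ^ 2)),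
                2 * t / ((((u ᵥ* T) ⬝ᵥ u : F) : v.adicCompletion F) * (1 - (d : v.adicCompletion F) * t ^ 2))) •
            vecMulVec (fun k => toLocalRing E v ((u k : F) : v.adicCompletion F))
              ((fun k => toLocalRing E v ((u k : F) : v.adicCompletion F)) ᵥ*
                (T.map (algebraMap F (v.adicCompletion F))).map (toLocalRing E v)) ∧
        (UnitaryGroup.localPiEquiv E c N J v).symm g ∈ K := by
  set cu : F := (u ᵥ* T) ⬝ᵥ u with hcu_def
  set uv : Fin N → UnitaryGroup.LocalRing E v := fun k => toLocalRing E v ((u k : F) : (v.adicCompletion F)) with huv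
  set Jv := (T.map (algebraMap F (v.adicCompletion F))).map (toLocalRing E v) with hJv
  set P := vecMulVec uv (uv ᵥ* Jv) with hP
  -- the parameter as a function of `t`
  set af : (v.adicCompletion F) → UnitaryGroup.LocalRing E v := fun t => (quadraticLocalEquiv E v c hcδ hδ)
    (2 * (d : (v.adicCompletion F)) * t ^ 2 / ((cu : (v.adicCompletion F)) * (1 - (d : (v.adicCompletion F)) * t ^ 2)), 2 * t / ((cu : (v.adicCompletion F)) * (1 - (d : (v.adicCompletion F)) * t ^ 2))) with haf
  -- the good set `{|dt²| < 1}` is an open neighbourhood of `0`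
  set G : Set (v.adicCompletion F) := {t | normAbs (v.adicCompletion F) ((d : (v.adicCompletion F)) * t ^ 2) < 1} with hG
  have hGo : IsOpen G := isOpen_lt (LocalFieldHaar.continuous_normAbs.comp (by fun_prop)) continuous_const
  have hG0 : (0 : (v.adicCompletion F)) ∈ G := by simp [hG]
  have hD : ∀ t ∈ G, 1 - (d : (v.adicCompletion F)) * t ^ 2 ≠ 0 := by
    intro t ht h0
    have h1 : (d : (v.adicCompletion F)) * t ^ 2 = 1 := (sub_eq_zero.1 h0).symm
    have h2 : normAbs (v.adicCompletion F) ((d : (v.adicCompletion F)) * t ^ 2) < 1 := ht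
    rw [h1, map_one] at h2
    exact lt_irrefl _ h2
  have hcuK : (cu : (v.adicCompletion F)) ≠ 0 := by
    intro h0
    apply hcu
    apply (algebraMap F (v.adicCompletion F)).injective
    rw [map_zero]
    exact h0
  have hcuv : (uv ᵥ* Jv) ⬝ᵥ uv = toLocalRing E v ((cu : F) : (v.adicCompletion F)) := ratVec_vecMul_dotProduct E T v u
  have hrel : ∀ t ∈ G, af t + conjLocal E c v (af t) + af t * conjLocal E c v (af t) * ((uv ᵥ* Jv) ⬝ᵥ uv) = 0 := by
    intro t ht
    rw [hcuv]
    exact reflParam_rel E c hcδ hδ hd v cu hcu t (hD t ht)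
  -- the «local» element for `t ∈ G`
  have hex : ∀ t : G, ∃ g : UnitaryGroup.«local» E c N J v, (g : GL (Fin N) (UnitaryGroup.LocalRing E v)).val = 1 + af t • P :=
    fun t => reflMatrix_mem_local E c T hT hJ v u (hrel t.1 t.2)
  choose f hf using hex
  -- `f` is continuous
  have haf_cont : Continuous fun t : G => af t := by
    have hden : ∀ t : G, (cu : (v.adicCompletion F)) * (1 - (d : (v.adicCompletion F)) * (t : (v.adicCompletion F)) ^ 2) ≠ 0 := fun t => mul_ne_zero hcuK (hD t.1 t.2)
    refine (quadraticLocalEquiv E v c hcδ hδ).continuous.comp (Continuous.prodMk ?_ ?_)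
    · exact Continuous.div (by fun_prop) (by fun_prop) hden
    · exact Continuous.div (by fun_prop) (by fun_prop) hden
  have hinv : ∀ t : G, ((f t : GL (Fin N) (UnitaryGroup.LocalRing E v))⁻¹).val = 1 + conjLocal E c v (af t) • P := by
    intro t
    apply Units.inv_eq_of_mul_eq_one_right
    rw [hf t, reflMatrix_mul_reflMatrix, hrel t.1 t.2, zero_smul, add_zero]
  have hfc : Continuous f := by
    rw [continuous_induced_rng, Units.continuous_iff]
    constructor
    · have : (Units.val ∘ Subtype.val ∘ f) = fun t : G => 1 + af (t : (v.adicCompletion F)) • P := funext fun t => hf t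
      rw [show (Units.val ∘ (Subtype.val ∘ f)) = fun t : G => 1 + af (t : (v.adicCompletion F)) • P from this]
      exact continuous_const.add (haf_cont.smul continuous_const)
    · have : (fun t : G => (((Subtype.val ∘ f) t)⁻¹ : GL (Fin N) (UnitaryGroup.LocalRing E v)).val) =
          fun t : G => 1 + conjLocal E c v (af (t : (v.adicCompletion F))) • P := funext fun t => hinv t
      rw [this]
      exact continuous_const.add (((UnitaryGroup.continuous_conjLocal E c v).comp haf_cont).smul continuous_const)
  -- `f 0 = 1`
  have hf0 : f ⟨0, hG0⟩ = 1 := by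
    apply Subtype.ext
    apply Units.ext
    rw [hf]
    have : af 0 = 0 := by simp [haf]
    simp [this]
  -- pull back the open subgroup
  have hpre : (fun t : G => (UnitaryGroup.localPiEquiv E c N J v).symm (f t)) ⁻¹' (K : Set _) ∈ 𝓝 (⟨0, hG0⟩ : G) := by
    refine (hK.preimage ((UnitaryGroup.localPiEquiv E c N J v).symm.continuous.comp hfc)).mem_nhds ?_
    show (UnitaryGroup.localPiEquiv E c N J v).symm (f ⟨0, hG0⟩) ∈ K
    rw [hf0, map_one]
    exact K.one_mem
  rw [mem_nhds_subtype] at hpre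
  obtain ⟨V, hV, hVsub⟩ := hpre
  obtain ⟨n₁, hn₁⟩ := exists_primePowBall_subset_of_mem_nhds_zero (Filter.inter_mem hV (hGo.mem_nhds hG0))
  refine ⟨n₁, fun t ht => ?_⟩
  have htV : t ∈ V := (hn₁ ht).1
  have htG : t ∈ G := (hn₁ ht).2
  refine ⟨htG, f ⟨t, htG⟩, hf ⟨t, htG⟩, ?_⟩
  exact hVsub (show (⟨t, htG⟩ : G) ∈ Subtype.val ⁻¹' V from htV)

end Family

end Literature.NumberTheory.Automorphic.UnitaryGroup

end
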